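import Summits.NavierStokesRegularity.FunctionalMining.TopEigDensityIdentity
import Literature.Analysis.Matrix.KyFanMaximumPrinciple
import HarnessLib

/-!
# FunctionalMining — every sorted strain eigenvalue is continuous on the torus (Weyl's inequality);
# in particular `λ₂ = torusStrainMidEig` and `λ₃ = torusStrainBotEig` are continuous

Search for candidate a priori estimates; no regularity claim. Cell `pub-nsfunc`, prove seat
(gen 23). The dictionary's eigenvalue densities (`StrainEigen.lean`: sorted `torusStrainEig v x`,
`torusStrainTopEig = λ₁`, `torusStrainMidEig = λ₂`, `torusStrainBotEig = λ₃`) enter the cell's rows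
(`torusMidEigPosMoment`, `torusNegBotEigMoment`, the simple set `U_s = {λ₂ < λ₁}` of F1 PART I).
The tree has `TopEig.continuous_torusStrainTopEig`; here, from Weyl's perturbation inequalities of
the Literature Ky Fan file (`KyFan.eigenvalues₀_add_le_add_max`, `KyFan.eigenvalues₀_add_min_le`,
Horn–Johnson Thm. 4.3.1):

* `abs_eigenvalues₀_sub_le_norm` — `|λⱼ↓(C) − λⱼ↓(A)| ≤ ‖flat(C − A)‖` for real symmetric `A`, `C`
  (Frobenius norm of the difference);
* `abs_torusStrainEig_sub_le` — `|λⱼ(S(v)(y)) − λⱼ(S(v)(x))| ≤ ‖strainFlat v y − strainFlat v x‖`;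
* **`continuous_torusStrainEig`** — `x ↦ λⱼ(x)` is continuous for smooth `v` (every `j`, every `d`);
* **`continuous_torusStrainBotEig`**, **`continuous_torusStrainMidEig`**, `isOpen_setOf_midEig_lt_topEig'`
  (`U_s` open in every dimension).

[folklore; cite: HornJohnson2013, Thm. 4.3.1 (Weyl)]
-/

noncomputable section

open Filter Topology Matrix Finset
open scoped ContDiff

namespace Summit.NavierStokesRegularity.FunctionalMining

open Literature.Analysis Literature.Analysis.FunctionSpaces Literature.Analysis.FunctionSpaces.Torus
  SharpClass.DirectorForm Literature.Analysis.Matrix TopEig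

/-! ## 1. Weyl: sorted eigenvalues are `1`-Lipschitz in the Frobenius norm -/

section MatrixLevel

variable {ι : Type*} [Fintype ι] [DecidableEq ι]

/-- Sorted eigenvalues of equal matrices agree (transport of the `IsHermitian` proof). [folklore] -/
private theorem eigenvalues₀_eq_of_eq {M M' : Matrix ι ι ℝ} (hM : M.IsHermitian) (hM' : M'.IsHermitian)
    (h : M = M') : hM.eigenvalues₀ = hM'.eigenvalues₀ := by
  subst h
  rfl

omit [Fintype ι] [DecidableEq ι] in
/-- `flat (−B) = −flat B`. [ours, bookkeeping] -/
private theorem flat_neg (B : Matrix ι ι ℝ) : flat (-B) = -flat B := by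
  ext p
  simp [flat]

/-- **WEYL'S INEQUALITY, two-sided form**: for real symmetric `A`, `C` and every sorted index `j`,
`|λⱼ↓(C) − λⱼ↓(A)| ≤ ‖flat (C − A)‖` (`λⱼ↓(A) + λ_min(C − A) ≤ λⱼ↓(C) ≤ λⱼ↓(A) + λ_max(C − A)` and
`|λ_max|, |λ_min| ≤ ‖·‖`). [cite: HornJohnson2013, Thm. 4.3.1] -/
theorem abs_eigenvalues₀_sub_le_norm [Nonempty ι] {A C : Matrix ι ι ℝ} (hA : A.IsHermitian)
    (hC : C.IsHermitian) (j : Fin (Fintype.card ι)) :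
    |hC.eigenvalues₀ j - hA.eigenvalues₀ j| ≤ ‖flat (C - A)‖ := by
  have hn : 1 ≤ Fintype.card ι := Fintype.card_pos
  have hB : (C - A).IsHermitian := hC.sub hA
  have hAB : (A + (C - A)).IsHermitian := by rw [add_sub_cancel]; exact hC
  have heq : hAB.eigenvalues₀ = hC.eigenvalues₀ := eigenvalues₀_eq_of_eq hAB hC (add_sub_cancel A C)
  -- upper Weyl bound
  have hup := KyFan.eigenvalues₀_add_le_add_max hA hB hAB hn j
  -- lower Weyl bound
  have hlo := KyFan.eigenvalues₀_add_min_le hA hB hAB hn j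
  rw [heq] at hup hlo
  -- `λ_max(B) = lam (flat B) ≤ ‖flat B‖`
  have hmax : hB.eigenvalues₀ (Fin.castLE hn 0) ≤ ‖flat (C - A)‖ := by
    rw [← lam_eq_eigenvalues₀ (A := flat (C - A)) hB (fun i j => flat_apply _ i j) hn]
    exact lam_le_norm _
  -- `λ_min(B) = −λ_max(−B) ≥ −‖flat B‖`
  have hB' : (-(C - A)).IsHermitian := hB.neg
  have hmin : -‖flat (C - A)‖ ≤ hB.eigenvalues₀ (Fin.rev (Fin.castLE hn 0)) := by
    have h1 := KyFan.eigenvalues₀_neg hB hB' (Fin.castLE hn 0)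
    -- `h1 : hB'.eigenvalues₀ (castLE 0) = −hB.eigenvalues₀ (rev (castLE 0))`
    have h2 : hB'.eigenvalues₀ (Fin.castLE hn 0) ≤ ‖flat (-(C - A))‖ := by
      rw [← lam_eq_eigenvalues₀ (A := flat (-(C - A))) hB' (fun i j => flat_apply _ i j) hn]
      exact lam_le_norm _
    rw [flat_neg, norm_neg, h1] at h2
    linarith
  rw [abs_le]
  constructor <;> linarith

end MatrixLevel

/-! ## 2. Continuity of the sorted strain eigenvalues on the torus -/

variable {d : Type*} [Fintype d] [DecidableEq d]

/-- **`|λⱼ(S(v)(y)) − λⱼ(S(v)(x))| ≤ ‖strainFlat v y − strainFlat v x‖`** for every sorted index `j`.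
[cite: HornJohnson2013, Thm. 4.3.1] -/
theorem abs_torusStrainEig_sub_le [Nonempty d] (v : UnitAddTorus d → EuclideanSpace ℝ d)
    (x y : UnitAddTorus d) (j : Fin (Fintype.card d)) :
    |torusStrainEig v y j - torusStrainEig v x j| ≤
      ‖StrainL4.strainFlat v y - StrainL4.strainFlat v x‖ := by
  have h := abs_eigenvalues₀_sub_le_norm (torusStrainMatrix_isHermitian v x)
    (torusStrainMatrix_isHermitian v y) j
  have hflat : flat (torusStrainMatrix v y - torusStrainMatrix v x) =
      StrainL4.strainFlat v y - StrainL4.strainFlat v x := by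
    rw [← flat_torusStrainMatrix, ← flat_torusStrainMatrix]
    ext p
    simp [flat]
  rw [hflat] at h
  exact h

/-- **EVERY SORTED STRAIN EIGENVALUE IS CONTINUOUS** on the torus, for a smooth field (any dimension).
[folklore; Weyl] -/
theorem continuous_torusStrainEig [Nonempty d] {v : UnitAddTorus d → EuclideanSpace ℝ d}
    (hv : Torus.IsSmooth v) (j : Fin (Fintype.card d)) :
    Continuous fun x => torusStrainEig v x j := by
  have hS : Continuous (StrainL4.strainFlat v) := StrainL4.continuous_strainFlat hv
  refine Metric.continuous_iff.2 fun x ε hε => ?_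
  obtain ⟨δ, hδ, hδ'⟩ := Metric.continuous_iff.1 hS x ε hε
  refine ⟨δ, hδ, fun y hy => ?_⟩
  rw [Real.dist_eq]
  have h1 := abs_torusStrainEig_sub_le v x y j
  have h2 := hδ' y hy
  rw [dist_eq_norm] at h2
  linarith

/-- The infimum of an antitone family on `Fin n` (`1 ≤ n`) is its value at the last index. [folklore] -/
private theorem iInf_eq_apply_last_of_antitone {n : ℕ} (hn : 1 ≤ n) {f : Fin n → ℝ} (hf : Antitone f) :
    (⨅ k, f k) = f (Fin.rev (Fin.castLE hn 0)) := by
  haveI : Nonempty (Fin n) := ⟨Fin.castLE hn 0⟩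
  refine le_antisymm (ciInf_le (Set.finite_range f).bddBelow _) (le_ciInf fun k => hf ?_)
  rw [Fin.le_iff_val_le_val, Fin.val_rev, Fin.val_castLE, Fin.val_zero]
  omega

/-- **`λ₃ = torusStrainBotEig` is continuous** for a smooth field. [folklore; Weyl] -/
theorem continuous_torusStrainBotEig [Nonempty d] {v : UnitAddTorus d → EuclideanSpace ℝ d}
    (hv : Torus.IsSmooth v) : Continuous (torusStrainBotEig v) := by
  have hn : 1 ≤ Fintype.card d := Fintype.card_pos
  have hfun : torusStrainBotEig v = fun x => torusStrainEig v x (Fin.rev (Fin.castLE hn 0)) := by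
    funext x
    exact iInf_eq_apply_last_of_antitone hn (torusStrainEig_antitone v x)
  rw [hfun]
  exact continuous_torusStrainEig hv _

/-- **`λ₂ = torusStrainMidEig` (`:= tr S − λ₁ − λ₃`, binder-free) is continuous** for a smooth
field. [folklore; Weyl] -/
theorem continuous_torusStrainMidEig [Nonempty d] {v : UnitAddTorus d → EuclideanSpace ℝ d}
    (hv : Torus.IsSmooth v) : Continuous (torusStrainMidEig v) := by
  have hn : 1 ≤ Fintype.card d := Fintype.card_pos
  have htop : torusStrainTopEig v = fun x => torusStrainEig v x (Fin.castLE hn 0) := by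
    funext x
    exact iSup_eq_apply_zero_of_antitone hn (torusStrainEig_antitone v x)
  have hsum : Continuous fun x => ∑ k, torusStrainEig v x k :=
    continuous_finsetSum _ fun k _ => continuous_torusStrainEig hv k
  unfold torusStrainMidEig
  rw [htop]
  exact (hsum.sub (continuous_torusStrainEig hv _)).sub (continuous_torusStrainBotEig hv)

/-- **`U_s = {λ₂ < λ₁}` is open, second proof** (by continuity of `λ₁` and `λ₂`; cf.
`TopEig.isOpen_setOf_midEig_lt_topEig`), in every dimension. [folklore] -/
theorem isOpen_setOf_midEig_lt_topEig' [Nonempty d] {v : UnitAddTorus d → EuclideanSpace ℝ d}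
    (hv : Torus.IsSmooth v) :
    IsOpen {x : UnitAddTorus d | torusStrainMidEig v x < torusStrainTopEig v x} := by
  have hn : 1 ≤ Fintype.card d := Fintype.card_pos
  have htop : Continuous (torusStrainTopEig v) := by
    have h : torusStrainTopEig v = fun x => torusStrainEig v x (Fin.castLE hn 0) := by
      funext x
      exact iSup_eq_apply_zero_of_antitone hn (torusStrainEig_antitone v x)
    rw [h]
    exact continuous_torusStrainEig hv _
  exact isOpen_lt (continuous_torusStrainMidEig hv) htop

end Summit.NavierStokesRegularity.FunctionalMining

end
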